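import Summits.QuantumFields.YangMills.Theses.ColdStartUniversality
import Literature.MathematicalPhysics.QuantumFieldTheory.Balaban1983to89.T4GenFunBounds
import Literature.MathematicalPhysics.QuantumFieldTheory.Balaban1983to89.T4ApexTwoLevel
import HarnessLib

/-!
# Route `ColdStartUniversality`, crux K_A1|Γ `NeutralColdStartMixing` (stmt-QuantumFields-27363), LINE 7
# «valley_averaging»: THE VALLEY MODULO THE CENTRE — the composition goes through verbatim with the valley coordinate
# `θ_K` replaced by `|θ_K|` (componentwise), a centre-BLIND coordinate

Helper file (seat `ym-line-csu-p1`, g14; `--supports stmt-QuantumFields-27363`).  Second re-typing option for LINE 7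
after `…ValleyChargedSector` (p720043: stub 2 as typed carries the charged sector) and `…EvenValleyMixing` (p720334:
restrict stub 2 to twist-invariant test functions).  The `Z₂³` centre twists act on the valley coordinate
`θ_K = (|USite|⁻¹ Σ_x avgObs K (polyakov μ x))_μ` by independent sign flips of the three components
(`wind_polyakov_eq`), so the centre-even valley observables are exactly the functions of `|θ_K| := (|θ_K,μ|)_μ` — the
valley coordinate MODULO THE CENTRE (the torons `T³/(Weyl ⋉ Z₂³)` seen by even strings).  Replacing `θ_K` by `|θ_K|`
in BOTH stubs of the registered skeleton (conditioning σ-algebra of stub 1 = `σ(|θ_K|)`; test functions of stub 2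
measurable w.r.t. `σ(|θ_K|)`) leaves the planner's composition VERBATIM valid:

* ★ `neutralColdStartMixing_of_absValleyTracking_of_absValleyMixing` —
  `AdiabaticValleyTracking[θ ↦ |θ|] → ValleyCesaroMixing[θ ↦ |θ|] → NeutralColdStartMixing` (both hypotheses = items
  27403 / 27404 verbatim with the single textual substitution; spelled inline, no new definition).

With this re-typing stub 2 no longer quantifies over centre-odd test functions (the signed Polyakov line `θ_K,μ` is not
`σ(|θ_K|)`-measurable), and stub 1 has the same content as before on the even strings it is asked for (for a
centre-even string `E_Gibbs[g | σ(θ)]` is twist-invariant a.e., `…EvenValleyMixing`, hence a version of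
`E_Gibbs[g | σ(|θ|)]`).  THEOREMS ONLY; custody information for the planner / critic; no crux, rung or summit statement
is proved here and the Yang–Mills mass gap is NOT proved.
-/

set_option autoImplicit false

noncomputable section

namespace Summit.QuantumFields.YangMills.Theorems.ColdStartUniversality

open MeasureTheory Filter
open Literature.MathematicalPhysics.QuantumFieldTheory
open Literature.MathematicalPhysics.QuantumLattice (fundamentalRep continuous_fundamentalRep)
open Literature.MathematicalPhysics.QuantumFieldTheory.Balaban1983to89

/-- ★★ **K_A1|Γ FROM THE TWO VALLEY STUBS RE-TYPED MODULO THE CENTRE.**  Items 27403 (`AdiabaticValleyTracking`) and 27404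
(`ValleyCesaroMixing`) with the valley coordinate `θ_K` replaced by its componentwise absolute value `|θ_K|` imply
`NeutralColdStartMixing` — the registered composition of line «valley_averaging» (tower property of the valley projection
+ ε/3), verbatim. [cite: tHooft1979Flux, §2] -/
theorem neutralColdStartMixing_of_absValleyTracking_of_absValleyMixing
    (h1 : ∃ γ₁ : ℝ, 0 < γ₁ ∧ ∀ (F : Literature.MathematicalPhysics.QuantumFieldTheory.Balaban1983to89.T3ContinuumYM3Torus.T3Family) (γ : ℝ), 0 < γ → γ ≤ γ₁ → ∀ (os : List (Literature.MathematicalPhysics.QuantumFieldTheory.Balaban1983to89.T3ContinuumYM3Torus.ULoop3 F)), (∀ μ : Fin 3, Even (os.map (Literature.MathematicalPhysics.QuantumFieldTheory.Balaban1983to89.T3ContinuumYM3Torus.ULoop3.wind μ)).sum) → ∀ (δ : ℝ), 0 < δ → ∃ c : ℝ, 0 ≤ c ∧ ∃ K₀ : ℕ, ∀ K : ℕ, K₀ ≤ K → ∀ (Ω : Type) (mΩ : MeasurableSpace Ω) (P : MeasureTheory.Measure Ω) (hP : MeasureTheory.IsProbabilityMeasure P) (W : NNReal → Ω → (Literature.MathematicalPhysics.QuantumFieldTheory.Edge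 3 ((F.P K).sitesPerDir 0) × Literature.MathematicalPhysics.QuantumFieldTheory.NoiseIdx 2 → ℝ)) (hW : Literature.MathematicalPhysics.QuantumFieldTheory.IsFlatBrownian W P) (U : NNReal → Ω → Literature.MathematicalPhysics.QuantumFieldTheory.GaugeConfig 3 ((F.P K).sitesPerDir 0) (Matrix.specialUnitaryGroup (Fin 2) ℂ)), (∀ ω, U 0 ω = fun _ => 1) → (Literature.MathematicalPhysics.QuantumFieldTheory.latticeLangevinDynamics (⟨2, Literature.MathematicalPhysics.QuantumLattice.fundamentalRep (Fin 2), Literature.MathematicalPhysics.QuantumLattice.continuous_fundamentalRep _, Literature.MathematicalPhysics.QuantumLattice.fundamentalRep_injective _, Literature.MathematicalPhysics.QuantumLattice.fundamentalRep_mem_unitaryGroup⟩ : Literature.MathematicalPhysics.QuantumFieldTheory.LatticeRep (Matrix.specialUnitaryGroup (Fin 2) ℂ)) ((γ * (F.P K).eps)⁻¹ / 2)).IsSolution (Literature.MathematicalPhysics.QuantumLattice.fundamentalRep (Fin 2)) hW.natFiltration P W U → ∀ (T : ℝ), 0 < T → |intervalIntegral (fun s : ℝ => MeasureTheory.integral P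 (fun ω => (MeasureTheory.condExp (MeasurableSpace.comap (fun (V : Literature.MathematicalPhysics.QuantumFieldTheory.Balaban1983to89.GaugeField (F.P K) 0 (Matrix.specialUnitaryGroup (Fin 2) ℂ)) (μ : Fin 3) => |(Fintype.card F.USite : ℝ)⁻¹ * ∑ x : F.USite, F.avgObs (Literature.MathematicalPhysics.QuantumFieldTheory.Balaban1983to89.ExpMeanLog.expMeanLogSU : Literature.MathematicalPhysics.QuantumFieldTheory.Balaban1983to89.LoopAverage (Matrix.specialUnitaryGroup (Fin 2) ℂ)) K (Literature.MathematicalPhysics.QuantumFieldTheory.Balaban1983to89.T3ContinuumYM3Torus.ULoop3.polyakov μ x) V|) MeasurableSpace.pi) (Literature.MathematicalPhysics.QuantumFieldTheory.Balaban1983to89.T4GenFunBounds.gibbsMeasure (G := Matrix.specialUnitaryGroup (Fin 2) ℂ) (F.P K) ((F.scheme (Literature.MathematicalPhysics.QuantumFieldTheory.Balaban1983to89.ExpMeanLog.expMeanLogSU : Literature.MathematicalPhysics.QuantumFieldTheory.Balaban1983to89.LoopAverage (Matrix.specialUnitaryGroup (Fin 2) ℂ)) γ).β K)) (fun V : Literature.MathematicalPhysics.QuantumFieldTheory.Balaban1983to89.GaugeField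 (F.P K) 0 (Matrix.specialUnitaryGroup (Fin 2) ℂ) => (os.map fun C => F.avgObs (Literature.MathematicalPhysics.QuantumFieldTheory.Balaban1983to89.ExpMeanLog.expMeanLogSU : Literature.MathematicalPhysics.QuantumFieldTheory.Balaban1983to89.LoopAverage (Matrix.specialUnitaryGroup (Fin 2) ℂ)) K C V).prod)) (fun b : Literature.MathematicalPhysics.QuantumFieldTheory.Balaban1983to89.PBond (F.P K) 0 => U (s / (F.P K).eps).toNNReal ω (b.src, b.dir)))) 0 T MeasureTheory.volume - intervalIntegral (fun s : ℝ => MeasureTheory.integral P (fun ω => (os.map fun C => F.avgObs (Literature.MathematicalPhysics.QuantumFieldTheory.Balaban1983to89.ExpMeanLog.expMeanLogSU : Literature.MathematicalPhysics.QuantumFieldTheory.Balaban1983to89.LoopAverage (Matrix.specialUnitaryGroup (Fin 2) ℂ)) K C (fun b : Literature.MathematicalPhysics.QuantumFieldTheory.Balaban1983to89.PBond (F.P K) 0 => U (s / (F.P K).eps).toNNReal ω (b.src, b.dir))).prod)) 0 T MeasureTheory.volume| ≤ δ * T + c)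
    (h2 : ∃ γ₁ : ℝ, 0 < γ₁ ∧ ∀ (F : Literature.MathematicalPhysics.QuantumFieldTheory.Balaban1983to89.T3ContinuumYM3Torus.T3Family) (γ : ℝ), 0 < γ → γ ≤ γ₁ → ∀ (δ : ℝ), 0 < δ → ∃ T₀ : ℝ, 0 < T₀ ∧ ∃ K₀ : ℕ, ∀ K : ℕ, K₀ ≤ K → ∀ (h : Literature.MathematicalPhysics.QuantumFieldTheory.Balaban1983to89.GaugeField (F.P K) 0 (Matrix.specialUnitaryGroup (Fin 2) ℂ) → ℝ), @MeasureTheory.StronglyMeasurable _ _ _ (MeasurableSpace.comap (fun (V : Literature.MathematicalPhysics.QuantumFieldTheory.Balaban1983to89.GaugeField (F.P K) 0 (Matrix.specialUnitaryGroup (Fin 2) ℂ)) (μ : Fin 3) => |(Fintype.card F.USite : ℝ)⁻¹ * ∑ x : F.USite, F.avgObs (Literature.MathematicalPhysics.QuantumFieldTheory.Balaban1983to89.ExpMeanLog.expMeanLogSU : Literature.MathematicalPhysics.QuantumFieldTheory.Balaban1983to89.LoopAverage (Matrix.specialUnitaryGroup (Fin 2) ℂ)) K (Literature.MathematicalPhysics.QuantumFieldTheory.Balaban1983to89.T3ContinuumYM3Torus.ULoop3.polyakov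 μ x) V|) MeasurableSpace.pi) h → (∀ᵐ V ∂(Literature.MathematicalPhysics.QuantumFieldTheory.Balaban1983to89.T4GenFunBounds.gibbsMeasure (G := Matrix.specialUnitaryGroup (Fin 2) ℂ) (F.P K) ((F.scheme (Literature.MathematicalPhysics.QuantumFieldTheory.Balaban1983to89.ExpMeanLog.expMeanLogSU : Literature.MathematicalPhysics.QuantumFieldTheory.Balaban1983to89.LoopAverage (Matrix.specialUnitaryGroup (Fin 2) ℂ)) γ).β K)), |h V| ≤ 1) → ∀ (Ω : Type) (mΩ : MeasurableSpace Ω) (P : MeasureTheory.Measure Ω) (hP : MeasureTheory.IsProbabilityMeasure P) (W : NNReal → Ω → (Literature.MathematicalPhysics.QuantumFieldTheory.Edge 3 ((F.P K).sitesPerDir 0) × Literature.MathematicalPhysics.QuantumFieldTheory.NoiseIdx 2 → ℝ)) (hW : Literature.MathematicalPhysics.QuantumFieldTheory.IsFlatBrownian W P) (U : NNReal → Ω → Literature.MathematicalPhysics.QuantumFieldTheory.GaugeConfig 3 ((F.P K).sitesPerDir 0) (Matrix.specialUnitaryGroup (Fin 2) ℂ)), (∀ ω, U 0 ω = fun _ =>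 1) → (Literature.MathematicalPhysics.QuantumFieldTheory.latticeLangevinDynamics (⟨2, Literature.MathematicalPhysics.QuantumLattice.fundamentalRep (Fin 2), Literature.MathematicalPhysics.QuantumLattice.continuous_fundamentalRep _, Literature.MathematicalPhysics.QuantumLattice.fundamentalRep_injective _, Literature.MathematicalPhysics.QuantumLattice.fundamentalRep_mem_unitaryGroup⟩ : Literature.MathematicalPhysics.QuantumFieldTheory.LatticeRep (Matrix.specialUnitaryGroup (Fin 2) ℂ)) ((γ * (F.P K).eps)⁻¹ / 2)).IsSolution (Literature.MathematicalPhysics.QuantumLattice.fundamentalRep (Fin 2)) hW.natFiltration P W U → ∀ (T : ℝ), T₀ ≤ T → |∫ V, h V ∂(Literature.MathematicalPhysics.QuantumFieldTheory.Balaban1983to89.T4GenFunBounds.gibbsMeasure (G := Matrix.specialUnitaryGroup (Fin 2) ℂ) (F.P K) ((F.scheme (Literature.MathematicalPhysics.QuantumFieldTheory.Balaban1983to89.ExpMeanLog.expMeanLogSU : Literature.MathematicalPhysics.QuantumFieldTheory.Balaban1983to89.LoopAverage (Matrix.specialUnitaryGroup (Fin 2) ℂ)) γ).β K)) - T⁻¹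 * intervalIntegral (fun s : ℝ => MeasureTheory.integral P (fun ω => h (fun b : Literature.MathematicalPhysics.QuantumFieldTheory.Balaban1983to89.PBond (F.P K) 0 => U (s / (F.P K).eps).toNNReal ω (b.src, b.dir)))) 0 T MeasureTheory.volume| ≤ δ) :
    Summit.QuantumFields.YangMills.Theses.ColdStartUniversality.NeutralColdStartMixing := by
  obtain ⟨γa, hγa, ha⟩ := h1
  obtain ⟨γb, hγb, hb⟩ := h2
  refine ⟨min γa γb, lt_min hγa hγb, fun F γ hγ hγle os hos δ hδ => ?_⟩
  obtain ⟨c, hc, K₁, hK₁⟩ := ha F γ hγ (hγle.trans (min_le_left _ _)) os hos (δ / 3) (by positivity)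
  obtain ⟨T₀, hT₀, K₂, hK₂⟩ := hb F γ hγ (hγle.trans (min_le_right _ _)) (δ / 3) (by positivity)
  set T : ℝ := max T₀ (3 * c / δ + 1) with hT
  have hTpos : 0 < T := lt_max_of_lt_left hT₀
  have hT₀le : T₀ ≤ T := le_max_left _ _
  have hcT : c / T ≤ δ / 3 := by
    have h3 : 3 * c / δ + 1 ≤ T := le_max_right _ _
    rw [div_le_iff₀ hTpos]
    calc c = δ / 3 * (3 * c / δ) := by field_simp
      _ ≤ δ / 3 * (3 * c / δ + 1) := by gcongr; linarith
      _ ≤ δ / 3 * T := by gcongr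
  refine ⟨T, hTpos, max K₁ K₂, fun K hK Ω mΩ P hP W hW U hU0 hUsol => ?_⟩
  -- the level-K objects
  set ℰ : LoopAverage (Matrix.specialUnitaryGroup (Fin 2) ℂ) := ExpMeanLog.expMeanLogSU with hℰ
  set μ0 := T4GenFunBounds.gibbsMeasure (G := Matrix.specialUnitaryGroup (Fin 2) ℂ) (F.P K) ((F.scheme ℰ γ).β K) with hμ0
  haveI : IsProbabilityMeasure μ0 :=
    T4GenFunBounds.isProbabilityMeasure_gibbsMeasure (G := Matrix.specialUnitaryGroup (Fin 2) ℂ) (F.P K) (F.scheme_β_nonneg ℰ hγ.le K)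
  set θ : GaugeField (F.P K) 0 (Matrix.specialUnitaryGroup (Fin 2) ℂ) → (Fin 3 → ℝ) := fun V μ =>
    |(Fintype.card F.USite : ℝ)⁻¹ * ∑ x : F.USite, F.avgObs ℰ K (T3ContinuumYM3Torus.ULoop3.polyakov μ x) V| with hθ
  set fstr : GaugeField (F.P K) 0 (Matrix.specialUnitaryGroup (Fin 2) ℂ) → ℝ := fun V =>
    (os.map fun C => F.avgObs ℰ K C V).prod with hfstr
  set vproj : GaugeField (F.P K) 0 (Matrix.specialUnitaryGroup (Fin 2) ℂ) → ℝ :=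
    MeasureTheory.condExp (MeasurableSpace.comap θ MeasurableSpace.pi) μ0 fstr with hvproj
  have hAvg : F.AvgMeasurable ℰ := F.avgMeasurable_of_measurableE ℰ T4ApexTwoLevel.measurableE_expMeanLogSU
  have hθm : Measurable θ := by
    refine measurable_pi_lambda _ fun μ => ?_
    exact ((Finset.measurable_sum _ fun x _ => F.measurable_avgObs hAvg K _).const_mul _).abs
  have hm : MeasurableSpace.comap θ MeasurableSpace.pi ≤
      (inferInstance : MeasurableSpace (GaugeField (F.P K) 0 (Matrix.specialUnitaryGroup (Fin 2) ℂ))) := hθm.comap_le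
  have hSM : @StronglyMeasurable _ _ _ (MeasurableSpace.comap θ MeasurableSpace.pi) vproj := stronglyMeasurable_condExp
  -- `|∏ of numbers in [-1,1]| ≤ 1` (tree: `abs_prod_map_le_one'`, inlined to stay out of the Theorems-over-Theses cone)
  have hprod : ∀ (f : T3ContinuumYM3Torus.ULoop3 F → ℝ), (∀ a, |f a| ≤ 1) →
      ∀ l : List (T3ContinuumYM3Torus.ULoop3 F), |(l.map f).prod| ≤ 1 := by
    intro f hf l
    induction l with
    | nil => simp
    | cons a l ih =>
      rw [List.map_cons, List.prod_cons, abs_mul]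
      exact mul_le_one₀ (hf a) (abs_nonneg _) ih
  have hfbd : ∀ V, |fstr V| ≤ 1 := fun V =>
    hprod (fun C => F.avgObs ℰ K C V) (fun C => F.abs_avgObs_le_one ℰ K C V) os
  have hbd : ∀ᵐ V ∂μ0, |vproj V| ≤ 1 :=
    ae_bdd_abs_condExp_of_ae_bdd_abs (m := MeasurableSpace.comap θ MeasurableSpace.pi) (μ := μ0) (R := (1 : ℝ))
      (f := fstr) (Filter.Eventually.of_forall hfbd)
  have hint : ∫ V, vproj V ∂μ0 = (F.scheme ℰ γ).expectAt K os := by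
    rw [hvproj, integral_condExp hm]
    exact (T4GenFunBounds.expectAt_eq_integral_gibbs _ (F.scheme_β_nonneg ℰ hγ.le) K os).symm
  have h1' := hK₁ K (le_of_max_le_left hK) Ω mΩ P hP W hW U hU0 hUsol T hTpos
  have h2' := hK₂ K (le_of_max_le_right hK) vproj hSM hbd Ω mΩ P hP W hW U hU0 hUsol T hT₀le
  rw [hint] at h2'
  set Ih : ℝ := intervalIntegral (fun s : ℝ => MeasureTheory.integral P (fun ω =>
      vproj (fun b : PBond (F.P K) 0 => U (s / (F.P K).eps).toNNReal ω (b.src, b.dir)))) 0 T volume with hIh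
  set If : ℝ := intervalIntegral (fun s : ℝ => MeasureTheory.integral P (fun ω =>
      (os.map fun C => F.avgObs ℰ K C (fun b : PBond (F.P K) 0 => U (s / (F.P K).eps).toNNReal ω (b.src, b.dir))).prod))
      0 T volume with hIf
  have hTinv : 0 < T⁻¹ := inv_pos.mpr hTpos
  have hthird : |T⁻¹ * Ih - T⁻¹ * If| ≤ δ / 3 + c / T := by
    rw [← mul_sub, abs_mul, abs_of_pos hTinv]
    calc T⁻¹ * |Ih - If| ≤ T⁻¹ * (δ / 3 * T + c) := by gcongr
      _ = δ / 3 + c / T := by field_simp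
  calc |(F.scheme ℰ γ).expectAt K os - T⁻¹ * If|
      ≤ |(F.scheme ℰ γ).expectAt K os - T⁻¹ * Ih| + |T⁻¹ * Ih - T⁻¹ * If| := abs_sub_le _ _ _
    _ ≤ δ / 3 + (δ / 3 + c / T) := add_le_add h2' hthird
    _ ≤ δ := by linarith

end Summit.QuantumFields.YangMills.Theorems.ColdStartUniversality

end
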